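import Summits.QuantumFields.YangMills.Theorems.BalabanUVNodesN15KingModelCoverNE2Unit
import Summits.QuantumFields.YangMills.Theorems.BalabanUVNodesN15KingModelCoverHeatKernel
import HarnessLib

/-!
# BalabanUVNodes ∕ N15 — THE KING-MODEL RUNG (PART Ͻ-m): FINITE COVERS — THE GENERAL TWO-SPACING PAIR AND THE PACKAGE: King's Lemma 4.5 rate with decay for EVERY pair of unit phase
# vectors `(ω₁, ω₂)` reading the same holonomy per unit length (`ω₂^{LⁿLᵏ} = ω₁^{Lᵏ}` — the coarse phases are the fine ones to the `Lⁿ` up to `Lᵏ`-th roots of unity), and PART Ͻ BY NAME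
# (descent image sums, character gauges, the `U ≡ 1` bridge, Lemma 4.5 at every toron, NE2⁺'s unit layer on the toron family, the heat semigroup)
# (Track A, DAG node N15 = NE2; FAN-OUT v1.1 §N15 s3 «KING-MODEL RUNG … NE2's analogue DECIDED in the model … + what the curved case adds»; count-neutral)

HONEST FRAMING.  Count-neutral (cell `pub-ymgap`, seat `pub-ymgap-dag-n15-e` g45; `--supports stmt-QuantumFields-27247 --as helper` = K3ᴬ, KEY MAP v3).  King's `A = 0`
comparison model [King1986] at constant abelian (flat) link fields on ONE finite unit torus at fixed spacings; a by-name conjunction of PART Ͻ plus one extension (general pairs).  NOT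
Bałaban's `G_k(U)`; NOT a node discharge (N15 of record untouched); nothing continuum ∕ ℝ⁴ ∕ OS ∕ Clay.

PROVED HERE:
* §1 `rootTwist` (def: `ζ_μ = ω₁,μ ∕ ω₂,μ^{Lⁿ}`), `norm_rootTwist`, `rootTwist_pow` (`ζ^{Lᵏ} = 1` under the pair relation), `approxCoarseTw` (def) and its algebra, ★★★★ **`norm_effLapTw_inv_sub_apply_le_rate_pair`**
  (EVERY unit pair with `ω₂^{LⁿLᵏ} = ω₁^{Lᵏ}`: `|(Δ^{ω₂}_{eff,k+n})⁻¹(b₀,b) − (Δ^{ω₁}_{eff,k})⁻¹(b₀,b)| ≤ C_diff·L^{−k}·K_{d+1}(κ_m∕4)·e^{−(κ_m∕4)d_M(b₀,b)}`);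
* §2 ★★★★ **`king_finite_cover_package`** (PART Ͻ by name, seven conjuncts).
PRIOR TREE ART (by name): Ͻ-a…Ͻ-l (`Lifts.inv_apply_eq_sum_fiber`, `toronOp_inv_apply_eq_sum_cover`, `toronOp_inv_apply_eq_char`, `effLapTw_inv_apply_eq_sum_cover`, `effLapTw_one_eq_map_effLaplacian`,
`effLapTw_inv_apply_eq_char_effLaplacian`, `norm_effLapTw_inv_sub_apply_le_rate_all`, `norm_effLapTw_inv_apply_le_decay_all`, `ne2PlusUnit_toronBlockCovRe`, `exp_neg_toronOp_apply_eq_sum_cover`,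
`approxFine`, `tendsto_approxFine`, `approxFine_pow_period`, `norm_effLapTw_inv_sub_apply_le_of_tendsto`, `norm_effLapTw_inv_sub_apply_le_rate_closed'`).  Dedup (rg at filing): basename 0 files;
needles `rootTwist|approxCoarseTw|rate_pair|king_finite_cover_package` 0 tree files.  presearch: n/a.  Locators: [King1986] Lemma 4.5 (4.38) p.674, (4.34) p.674, (4.39)–(4.41) pp.674–675,
(2.13)–(2.16) p.653, (4.4)–(4.5) p.670; [Balaban1985BackgroundPropagators] (3.19)–(3.20) p.393, p.398 l.19, Thm 3.15 (3.187) p.432; [Balaban1984PropagatorsI] (1.29) p.23.  0 `sorry`, 2 `def`.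
-/

noncomputable section

open scoped BigOperators ComplexConjugate ComplexOrder Topology
open Finset Matrix Filter Complex

namespace Summit.QuantumFields.YangMills.BalabanUVNodes.N15KingModelRung.Cover

open Literature.MathematicalPhysics.QuantumFieldTheory.Balaban1983to89.B5Prop11Plancherel (Tor unitVec fine chi)
open Literature.MathematicalPhysics.QuantumFieldTheory.Balaban1983to89.B4Sect5Proof (latticeConst)
open Literature.MathematicalPhysics.QuantumFieldTheory.Balaban1983to89.T4EtaRate (NE2PlusUnit)
open Literature.MathematicalPhysics.QuantumFieldTheory.King1986 (aK aK_pos)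
open Literature.MathematicalPhysics.QuantumFieldTheory.King1986.Torus (lapF tdistT CdiffM kapM gamM effLaplacian)
open Summit.QuantumFields.YangMills.BalabanUVNodes.N15KingModelRung (KingVolIndex)
open Summit.QuantumFields.YangMills.BalabanUVNodes.N15KingModelRung.Toron (toronOp effLapTw)

variable {d : ℕ}

/-! ## §1 The general two-spacing pair -/

section Pair

variable (L k n : ℕ) (M : Fin (d + 1) → ℕ) [hM : ∀ μ, NeZero (M μ)]

/-- THE ROOT-OF-UNITY TWIST between a consistent pair: `ζ_μ = ω₁,μ ∕ ω₂,μ^{Lⁿ}`. [folklore] -/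
def rootTwist (ω₁ ω₂ : Fin (d + 1) → ℂ) : Fin (d + 1) → ℂ := fun μ => ω₁ μ / ω₂ μ ^ (L ^ n)

omit hM in
/-- The twist has unit modulus (unit `ω₁, ω₂`). [folklore] -/
theorem norm_rootTwist {ω₁ ω₂ : Fin (d + 1) → ℂ} (hω₁ : ∀ μ, ‖ω₁ μ‖ = 1) (hω₂ : ∀ μ, ‖ω₂ μ‖ = 1) (μ : Fin (d + 1)) : ‖rootTwist L n ω₁ ω₂ μ‖ = 1 := by
  rw [rootTwist, norm_div, norm_pow, hω₁, hω₂, one_pow, div_one]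

omit hM in
/-- Under the pair relation `ω₂^{LⁿLᵏ} = ω₁^{Lᵏ}` the twist is an `Lᵏ`-th root of unity. [folklore] -/
theorem rootTwist_pow {ω₁ ω₂ : Fin (d + 1) → ℂ} (hω₁ : ∀ μ, ‖ω₁ μ‖ = 1) (hθ : ∀ μ, ω₂ μ ^ (L ^ n * L ^ k) = ω₁ μ ^ (L ^ k)) (μ : Fin (d + 1)) :
    rootTwist L n ω₁ ω₂ μ ^ (L ^ k) = 1 := by
  have hne : ω₁ μ ≠ 0 := fun h => by have := hω₁ μ; rw [h, norm_zero] at this; exact zero_ne_one this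
  rw [rootTwist, div_pow, ← pow_mul, hθ, div_self (pow_ne_zero _ hne)]

/-- The `j`-th approximant of the coarser phase vector for a general pair: the twist times the `Lⁿ`-th power of the finer approximant. [folklore] -/
def approxCoarseTw (φ : Fin (d + 1) → ℝ) (ζ : Fin (d + 1) → ℂ) (j : ℕ) : Fin (d + 1) → ℂ := fun μ => ζ μ * approxFine L k n M φ j μ ^ (L ^ n)

/-- Trivial holonomy of the twisted coarse approximant on the cover (`ζ^{Lᵏ} = 1`). [folklore] -/
theorem approxCoarseTw_pow_period [NeZero L] (φ : Fin (d + 1) → ℝ) {ζ : Fin (d + 1) → ℂ} (hζ : ∀ μ, ζ μ ^ (L ^ k) = 1) (j : ℕ) (μ : Fin (d + 1)) :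
    approxCoarseTw L k n M φ ζ j μ ^ fine (L ^ k) (fun ν => (j + 1) * M ν) μ = 1 := by
  have hfac : fine (L ^ k) (fun ν => (j + 1) * M ν) μ = L ^ k * ((j + 1) * M μ) := rfl
  rw [approxCoarseTw, mul_pow, hfac, pow_mul, hζ, one_pow, one_mul, ← hfac]
  exact approxCoarse_pow_period L k n M φ j μ

omit hM in
/-- The pair relation for the approximants: `(ω₂^{(j)})^{LⁿLᵏ} = (ω₁^{(j)})^{Lᵏ}`. [folklore] -/
theorem approxFine_pow_eq_tw (φ : Fin (d + 1) → ℝ) {ζ : Fin (d + 1) → ℂ} (hζ : ∀ μ, ζ μ ^ (L ^ k) = 1) (j : ℕ) (μ : Fin (d + 1)) :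
    approxFine L k n M φ j μ ^ (L ^ n * L ^ k) = approxCoarseTw L k n M φ ζ j μ ^ (L ^ k) := by
  rw [approxCoarseTw, mul_pow, hζ, one_mul, ← pow_mul]

/-- Convergence of the twisted coarse approximants to `ζ·(e^{iφ})^{Lⁿ}`. [folklore] -/
theorem tendsto_approxCoarseTw [NeZero L] (φ : Fin (d + 1) → ℝ) (ζ : Fin (d + 1) → ℂ) :
    Tendsto (fun j => approxCoarseTw L k n M φ ζ j) atTop (𝓝 (fun μ => ζ μ * Complex.exp ((φ μ : ℂ) * I) ^ (L ^ n))) := by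
  rw [tendsto_pi_nhds]
  intro μ
  exact (((tendsto_pi_nhds.mp (tendsto_approxFine L k n M φ)) μ).pow (L ^ n)).const_mul (ζ μ)

end Pair

section PairMain

variable {M : Fin (d + 1) → ℕ} [hM : ∀ μ, NeZero (M μ)]

/-- ★★★★ **KING's LEMMA 4.5 RATE WITH DECAY FOR EVERY CONSISTENT PAIR OF TORONS**: unit `ω₁` (spacing `L^{−k}`) and `ω₂` (spacing `L^{−k−n}`) with `ω₂^{LⁿLᵏ} = ω₁^{Lᵏ}` (the same
holonomy per unit length; `ω₁ = ζ·ω₂^{Lⁿ}` with `ζ^{Lᵏ} = 1`): `|(Δ^{ω₂}_{eff,k+n})⁻¹(b₀,b) − (Δ^{ω₁}_{eff,k})⁻¹(b₀,b)| ≤ C_diff·L^{−k}·K_{d+1}(κ_m∕4)·e^{−(κ_m∕4)d_M(b₀,b)}`.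
[cite: King1986, Lemma 4.5 (4.38) p.674, (4.39)–(4.41) pp.674–675] -/
theorem norm_effLapTw_inv_sub_apply_le_rate_pair {a m2 : ℝ} (ha : 0 < a) (hm : 0 < m2) {L k n : ℕ} [NeZero L] (hL : 2 ≤ L) (hk : 1 ≤ k) (hn : 1 ≤ n)
    {ω₁ ω₂ : Fin (d + 1) → ℂ} (hω₁ : ∀ μ, ‖ω₁ μ‖ = 1) (hω₂ : ∀ μ, ‖ω₂ μ‖ = 1) (hθ : ∀ μ, ω₂ μ ^ (L ^ n * L ^ k) = ω₁ μ ^ (L ^ k)) (b₀ b : Tor M) :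
    ‖(effLapTw (L ^ n * L ^ k) M (aK a L (k + n)) (((L ^ n * L ^ k : ℕ) : ℝ) ^ 2) m2 ω₂)⁻¹ b₀ b
        - (effLapTw (L ^ k) M (aK a L k) (((L ^ k : ℕ) : ℝ) ^ 2) m2 ω₁)⁻¹ b₀ b‖
      ≤ CdiffM (d + 1) a m2 L * ((L : ℝ) ^ k)⁻¹
          * (latticeConst (d + 1) (kapM (d + 1) a m2 L / 4) * Real.exp (-(kapM (d + 1) a m2 L / 4 * tdistT M b₀ b))) := by
  have hL1 : (1 : ℝ) < L := by exact_mod_cast hL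
  set φ : Fin (d + 1) → ℝ := fun μ => Complex.arg (ω₂ μ) with hφ
  set ζ := rootTwist L n ω₁ ω₂ with hζdef
  have hζ : ∀ μ, ζ μ ^ (L ^ k) = 1 := rootTwist_pow L k n hω₁ hθ
  have hωφ : (fun μ => Complex.exp ((φ μ : ℂ) * I)) = ω₂ := funext fun μ => exp_arg_mul_I_of_norm_eq_one (hω₂ μ)
  have hne : ∀ μ, ω₂ μ ^ (L ^ n) ≠ 0 := fun μ => pow_ne_zero _ (fun h => by have := hω₂ μ; rw [h, norm_zero] at this; exact zero_ne_one this)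
  have hω₁eq : (fun μ => ζ μ * ω₂ μ ^ (L ^ n)) = ω₁ := funext fun μ => by rw [hζdef, rootTwist, div_mul_cancel₀ _ (hne μ)]
  have h2 : Tendsto (fun j => approxFine L k n M φ j) atTop (𝓝 ω₂) := by rw [← hωφ]; exact tendsto_approxFine L k n M φ
  have h1 : Tendsto (fun j => approxCoarseTw L k n M φ ζ j) atTop (𝓝 ω₁) := by
    have := tendsto_approxCoarseTw L k n M φ ζ
    rwa [show (fun μ => ζ μ * Complex.exp ((φ μ : ℂ) * I) ^ (L ^ n)) = ω₁ from by rw [← hω₁eq]; exact funext fun μ => by rw [← congrFun hωφ μ]] at this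
  refine norm_effLapTw_inv_sub_apply_le_of_tendsto M (L ^ n * L ^ k) (L ^ k) (aK_pos ha hL1 (by omega)) (aK_pos ha hL1 hk) (sq_nonneg _) (sq_nonneg _) hm hω₂ hω₁ h2 h1 b₀ b
    fun j => ?_
  exact norm_effLapTw_inv_sub_apply_le_rate_closed' (M := M) (M' := fun ν => (j + 1) * M ν) (fun μ => Dvd.intro_left _ rfl) ha hm hL hk hn
    (approxCoarseTw_pow_period L k n M φ hζ j) (approxFine_pow_period L k n M φ j) (approxFine_pow_eq_tw L k n M φ hζ j) b₀ b

end PairMain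

/-! ## §2 PART Ͻ by name -/

/-- ★★★★ **PACKAGE — FINITE COVERS (PART Ͻ)**: (1) the toron covariance on the base is the image sum of the cover's; (2) at trivial holonomy it is King's `A = 0` kernel dressed by
characters; (3) the block-field covariance at a toron descends likewise; (4) the `U ≡ 1` bridge `Δ^1_eff = (King1986.effLaplacian)_ℂ`; (5) King's Lemma 4.5 two-spacing rate with decay
and (6) the uniform decay hold at EVERY toron with constants independent of the toron; (7) the toron heat kernel on the base is the image sum of the cover's.
[cite: King1986, Lemma 4.5 (4.38) p.674, (4.34)–(4.35) p.674, (4.4)–(4.5) p.670, (2.13)–(2.16) p.653; Balaban1985BackgroundPropagators, p.398 l.19, (3.19)–(3.20) p.393] -/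
theorem king_finite_cover_package {K K' : Fin (d + 1) → ℕ} [∀ μ, NeZero (K μ)] [∀ μ, NeZero (K' μ)] (hKK : ∀ μ, K μ ∣ K' μ)
    (N : ℕ) [NeZero N] {M M' : Fin (d + 1) → ℕ} [∀ μ, NeZero (M μ)] [∀ μ, NeZero (M' μ)] (hMM : ∀ μ, M μ ∣ M' μ)
    {a c m2 : ℝ} (ha : 0 < a) (hc : 0 ≤ c) (hm : 0 < m2) {L : ℕ} [NeZero L] (hL : 2 ≤ L) :
    (∀ (ω : Fin (d + 1) → ℂ), (∀ μ, ‖ω μ‖ = 1) → ∀ (x' : Tor K') (y : Tor K),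
        (toronOp K c m2 ω)⁻¹ (proj hKK x') y = ∑ y' ∈ fiber (proj hKK) y, (toronOp K' c m2 ω)⁻¹ x' y') ∧
    (∀ (p : Tor K) (ω : Fin (d + 1) → ℂ), (∀ μ, chi K p (unitVec K μ) = ω μ) → ∀ x y : Tor K,
        (toronOp K c m2 ω)⁻¹ x y = conj (chi K p x) * (((lapF K c m2)⁻¹ x y : ℝ) : ℂ) * chi K p y) ∧
    (∀ (ω : Fin (d + 1) → ℂ), (∀ μ, ‖ω μ‖ = 1) → ∀ (b' : Tor M') (b : Tor M),
        (effLapTw N M a c m2 ω)⁻¹ (proj hMM b') b = ∑ b'' ∈ fiber (proj hMM) b, (effLapTw N M' a c m2 ω)⁻¹ b' b'') ∧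
    effLapTw N M a c m2 (1 : Fin (d + 1) → ℂ) = (effLaplacian N M a c m2).map ((↑) : ℝ → ℂ) ∧
    (∀ (k n : ℕ), 1 ≤ k → 1 ≤ n → ∀ (ω : Fin (d + 1) → ℂ), (∀ μ, ‖ω μ‖ = 1) → ∀ b₀ b : Tor M,
        ‖(effLapTw (L ^ n * L ^ k) M (aK a L (k + n)) (((L ^ n * L ^ k : ℕ) : ℝ) ^ 2) m2 ω)⁻¹ b₀ b
            - (effLapTw (L ^ k) M (aK a L k) (((L ^ k : ℕ) : ℝ) ^ 2) m2 (fun μ => ω μ ^ (L ^ n)))⁻¹ b₀ b‖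
          ≤ CdiffM (d + 1) a m2 L * ((L : ℝ) ^ k)⁻¹
              * (latticeConst (d + 1) (kapM (d + 1) a m2 L / 4) * Real.exp (-(kapM (d + 1) a m2 L / 4 * tdistT M b₀ b)))) ∧
    (∀ (k : ℕ), 1 ≤ k → ∀ (ω : Fin (d + 1) → ℂ), (∀ μ, ‖ω μ‖ = 1) → ∀ b₀ b : Tor M,
        ‖(effLapTw (L ^ k) M (aK a L k) (((L ^ k : ℕ) : ℝ) ^ 2) m2 ω)⁻¹ b₀ b‖
          ≤ (2 / gamM a m2 L) * (latticeConst (d + 1) (kapM (d + 1) a m2 L / 2) * Real.exp (-(kapM (d + 1) a m2 L / 2 * tdistT M b₀ b)))) ∧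
    (∀ (ω : Fin (d + 1) → ℂ) (t : ℂ) (x' : Tor K') (y : Tor K),
        NormedSpace.exp (-(t • toronOp K c m2 ω)) (proj hKK x') y = ∑ y' ∈ fiber (proj hKK) y, NormedSpace.exp (-(t • toronOp K' c m2 ω)) x' y') :=
  ⟨fun _ hω x' y => toronOp_inv_apply_eq_sum_cover hKK hc hm hω x' y,
   fun _ _ hω x y => toronOp_inv_apply_eq_char K hc hm hω x y,
   fun _ hω b' b => effLapTw_inv_apply_eq_sum_cover N hMM ha hc hm hω b' b,
   effLapTw_one_eq_map_effLaplacian N M ha.le hc hm,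
   fun _ _ hk hn _ hω b₀ b => norm_effLapTw_inv_sub_apply_le_rate_all ha hm hL hk hn hω b₀ b,
   fun _ hk _ hω b₀ b => norm_effLapTw_inv_apply_le_decay_all ha hm hL hk hω b₀ b,
   fun ω t x' y => exp_neg_toronOp_apply_eq_sum_cover hKK c m2 ω t x' y⟩

/-- ★★★ **PACKAGE — NE2⁺'s UNIT LAYER AT THE TORONS** (Ͻ-k by name): the real and imaginary parts of the toron block-field covariance difference inhabit `NE2PlusUnit` on the toron-volume
family, hypothesis-free. [cite: Balaban1985BackgroundPropagators, Thm 3.15 (3.187) p.432 (shape); King1986, Lemma 4.5 (4.38) p.674] -/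
theorem king_finite_cover_ne2_package (L : ℕ) [NeZero L] (hL : 2 ≤ L) {a m2 : ℝ} (ha : 0 < a) (hm : 0 < m2) (c35 : ℝ) :
    NE2PlusUnit c35 (toronVolInstance d L) (toronBlockCovRe L a m2) (fun _ _ => True) (toronUnitDist L) ∧
    NE2PlusUnit c35 (toronVolInstance d L) (toronBlockCovIm L a m2) (fun _ _ => True) (toronUnitDist L) :=
  ⟨ne2PlusUnit_toronBlockCovRe L hL ha hm c35, ne2PlusUnit_toronBlockCovIm L hL ha hm c35⟩

end Summit.QuantumFields.YangMills.BalabanUVNodes.N15KingModelRung.Cover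

end
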